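import Summits.BirchSwinnertonDyer.BirchSwinnertonDyer.Theorems.ThetaPartnerAtTwoSignedControlAtTwoH1SigmaRankOne
import Literature.NumberTheory.EllipticCurves.IwasawaSelmerCoinvariantGrowthProofs
import Literature.NumberTheory.EllipticCurves.IwasawaSelmerTorsionCriterionProofs
import Literature.NumberTheory.EllipticCurves.H1SigmaDualFiniteProofs
import HarnessLib

/-!
# Greenberg's Thm. 1.7 growth mechanism for an ARBITRARY dual datum of a `conj_γ`-stable subgroup of
# `H¹(K_∞, E[p^∞])`: a torsion `Λ`-dual forces `#H^{γ^{pⁿ}}[p^k] ≤ C(n)·p^{kB}` (`B` independent of `n`)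

Crux K4 `SignedControlAtTwo` (stmt-BirchSwinnertonDyer-20309; routes `ThetaPartnerAtTwo` / `ResidualThetaTransportAtTwo`), line
`eulerchar` v8 (lead `prover-bsd-wall-tp2-p3` g3). The tree runs this mechanism for the SELMER dual datum
(`SelmerDualData.exists_natCard_fixedBy_torsion_le_of_isTorsion`, `…not_isTorsion_of_le_card_fixedBy_torsion`, file
`IwasawaSelmerCoinvariantGrowthProofs`); to feed the finite-level Euler-characteristic count (I1)
`relaxedSelmer_torsion_card_growth` DIRECTLY into the dual of `H = H¹(K_Σ/K_∞, E[p^∞])` (where no local condition at `v ∣ p` has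
to be relaxed, so that the Coates–Greenberg input (I2) of Thm. 1.7 is not needed) we re-run it VERBATIM for:
`Hsub` an additive subgroup of `H¹(K_∞, E[p^∞])`, `φ` an endomorphism of `Hsub` which is `conj_γ` on the nose (`γ` a topological
generator of the `ℤ_p`-extension `κ`), and `(Y, dY)` ANY Pontryagin-dual datum (`dY : Y ≅ Hom(Hsub, ℚ/ℤ)` bijective, `T ↦ φ − 1`,
constants through `ℤ_p → ℤ/p^k`), `Y` finitely generated:

* §1 `dY_smul` — the `Λ`-action read through `dY` is the canonical `IsLocNil.smulFun` (induction on the nilpotence index);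
  `coe_pow_apply_of_coe_eq_conjH1'` (`φ^m = conj_{γ^m}`);
* §2 `eq_zero_of_forall_dY_pow_apply_eq_zero`, `finite_smulTorsion_and_natCard_le` (`#Hsub[g, p^k] ≤ p^{k·d·deg g}`),
  `exists_isDistinguishedAt_forall_nsmul_eq_zero_of_isTorsion` (`p^n g ⋆ Hsub = 0` for `Y` torsion),
  `setOf_smulFun_omega_eq` (`Hsub[ω_m, p^k] = {s | conj_{γ^m} s = s, p^k s = 0}`);
* §3 `exists_natCard_fixedBy_torsion_le_of_isTorsion` and the contrapositives `not_isTorsion_of_unbounded_fixedBy_torsion`,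
  `not_isTorsion_of_le_card_fixedBy_torsion`.

Pure algebra over the tree's `IwasawaDual` layer; THEOREMS ONLY (no definition, no named fact, no `sorry`); nothing about any curve is
asserted; BSD is not proved by any of this.

References: [GreenbergLNM1716] §1 (Thm. 1.7 and the paragraph after it, pp. 60–62); [Washington1997] §13.2–13.3.
-/

set_option autoImplicit false
-- the Theorems namespace of this sub repeats the summit name by design (D-0017 nested layout)
set_option linter.dupNamespace false

noncomputable section

open scoped Classical NumberField

open NumberField IsDedekindDomain Polynomial

universe u

namespace Summit.BirchSwinnertonDyer.BirchSwinnertonDyer.Theorems.SignedEC.H1SigmaGrowth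

open Literature.NumberTheory.EllipticCurves Literature.NumberTheory.GaloisRepresentations
  WeierstrassCurve ZpExtension Literature.NumberTheory.EllipticCurves.IwasawaDual
  Literature.NumberTheory.EllipticCurves.IwasawaAlgebra

variable {K : Type u} [Field K] [NumberField K] (W : WeierstrassCurve K) {p : ℕ} [Fact p.Prime]
  (κ : ZpExtension K p) {γ : Field.absoluteGaloisGroup K} (hγ : κ.IsTopGenerator γ)
  (Hsub : AddSubgroup (W.subgroupH1 p κ.kerSubgroup)) (φ : AddMonoid.End Hsub)
  (hφ : ∀ s : Hsub, ((φ s : Hsub) : W.subgroupH1 p κ.kerSubgroup) = W.conjH1 p κ.kerSubgroup γ s)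

/-! ## §1 The `Λ`-action of any dual datum is the canonical one -/

include hφ in
omit [NumberField K] in
/-- `(φ^m) s = conj_{γ^m} s` for an endomorphism which is `conj_γ` on the nose (`conjH1_one`, `conjH1_mul`). [folklore] -/
theorem coe_pow_apply_of_coe_eq_conjH1' (m : ℕ) (s : Hsub) :
    (((φ ^ m) s : Hsub) : W.subgroupH1 p κ.kerSubgroup) = W.conjH1 p κ.kerSubgroup (γ ^ m) s := by
  induction m generalizing s with
  | zero => rw [pow_zero, pow_zero, AddMonoid.End.one_apply, W.conjH1_one_holds p κ.kerSubgroup,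
      AddMonoidHom.id_apply]
  | succ m ih =>
    rw [pow_succ, AddMonoid.End.coe_mul, Function.comp_apply, ih, hφ, pow_succ,
      W.conjH1_mul_holds p κ.kerSubgroup, AddMonoidHom.comp_apply]

variable {Y : Type*} [AddCommGroup Y] [Module (IwasawaAlgebra p) Y] (dY : Y →+ (Hsub →+ AddCircle (1 : ℚ)))
  (hT : ∀ (y : Y) (s : Hsub), dY ((PowerSeries.X : IwasawaAlgebra p) • y) s = dY y (φ s) - dY y s)
  (hC : ∀ (a : ℤ_[p]) (y : Y) (s : Hsub) (k : ℕ), (p ^ k) • s = 0 →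
    dY (PowerSeries.C a • y) s = (PadicInt.toZModPow k a).val • dY y s)

include hT hC in
/-- Induction carrier for `dY_smul` (as `SelmerDualData.toDual_smul_apply_of_pow_apply_eq_zero`): on classes killed by `(φ − 1)^N`
the action read through `dY` is `IsLocNil.smulFun` (peel off `f = T·g + C(a₀)`). [cite: GreenbergLNM1716, §1 p. 60] -/
theorem dY_smul_apply_of_pow_apply_eq_zero (N : ℕ) :
    ∀ (s : Hsub), ((φ - 1) ^ N) s = 0 → ∀ (f : IwasawaAlgebra p) (y : Y),
      dY (f • y) s = (W.isLocNil_sub_one_of_coe_eq_conjH1 κ hγ Hsub φ hφ).smulFun f (dY y) s := by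
  set h := W.isLocNil_sub_one_of_coe_eq_conjH1 κ hγ Hsub φ hφ
  set ψ : AddMonoid.End Hsub := φ - 1 with hψ
  induction N with
  | zero =>
    intro s hs f y
    rw [pow_zero, AddMonoid.End.one_apply] at hs
    rw [hs, map_zero, map_zero]
  | succ N ih =>
    intro s hs f y
    obtain ⟨k, hk⟩ := h.torsion s
    have hψs : (ψ ^ N) (ψ s) = 0 := by
      rwa [pow_succ, AddMonoid.End.coe_mul, Function.comp_apply] at hs
    have hψeval : ∀ y' : Y, dY y' (ψ s) = dY y' (φ s) - dY y' s := fun y' ↦ by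
      rw [hψ, IwasawaDual.End_sub_apply, AddMonoid.End.one_apply, map_sub]
    set g : IwasawaAlgebra p := PowerSeries.mk fun n ↦ PowerSeries.coeff (n + 1) f
    set a : ℤ_[p] := PowerSeries.constantCoeff f
    have hf : f = PowerSeries.X * g + PowerSeries.C a := PowerSeries.eq_X_mul_shift_add_const f
    have lhs : dY (f • y) s = dY (g • y) (ψ s) + (PadicInt.toZModPow k a).val • dY y s := by
      conv_lhs => rw [hf]
      rw [add_smul, mul_smul, map_add, AddMonoidHom.add_apply, hT, hC a y s k hk, hψeval]
    have rhs : h.smulFun f (dY y) s = h.smulFun g (dY y) (ψ s) + (PadicInt.toZModPow k a).val • dY y s := by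
      conv_lhs => rw [hf]
      rw [h.smulFun_add_left, h.smulFun_mul_left, AddMonoidHom.add_apply, h.smulFun_X_apply,
        h.smulFun_C_apply a (dY y) hk]
    rw [lhs, rhs, ih (ψ s) hψs g y]

include hT hC in
/-- **The `Λ`-action of ANY dual datum is forced**: `dY (f • y) = f ⋆ dY y` (canonical `IsLocNil.smulFun` for `φ − 1`).
[cite: GreenbergLNM1716, §1 p. 60] [cite: Washington1997, §13.2] -/
theorem dY_smul (f : IwasawaAlgebra p) (y : Y) :
    dY (f • y) = (W.isLocNil_sub_one_of_coe_eq_conjH1 κ hγ Hsub φ hφ).smulFun f (dY y) := by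
  ext s
  obtain ⟨N, hN⟩ := (W.isLocNil_sub_one_of_coe_eq_conjH1 κ hγ Hsub φ hφ).nil s
  exact dY_smul_apply_of_pow_apply_eq_zero W κ hγ Hsub φ hφ dY hT hC N s hN f y

/-! ## §2 Counting `Hsub[g, p^k]`, the distinguished killer, and `Hsub[ω_m, p^k]` -/

include hT hC in
/-- **Generators of `Y` and a monic relation detect the vanishing of a class** (VERBATIM `SelmerDualData.eq_zero_of_forall_toDual_pow_apply_eq_zero`
for the datum `(Y, dY)`). [cite: GreenbergLNM1716, §1 p. 60] [cite: Washington1997, §13.2] -/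
theorem eq_zero_of_forall_dY_pow_apply_eq_zero (hbij : Function.Bijective dY) {ι : Type*} (x : ι → Y)
    (hx : Submodule.span (IwasawaAlgebra p) (Set.range x) = ⊤) {g : ℤ_[p][X]} (hg : g.Monic)
    {k : ℕ} {s : Hsub} (hks : p ^ k • s = 0)
    (hgs : (W.isLocNil_sub_one_of_coe_eq_conjH1 κ hγ Hsub φ hφ).smulFun (g : IwasawaAlgebra p)
      (AddMonoidHom.id Hsub) s = 0)
    (h0 : ∀ i, ∀ j < g.natDegree, dY (x i) (((φ - 1) ^ j) s) = 0) :
    s = 0 := by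
  set h := W.isLocNil_sub_one_of_coe_eq_conjH1 κ hγ Hsub φ hφ
  set ψ : AddMonoid.End Hsub := φ - 1
  have h1 : ∀ i j, dY (x i) ((ψ ^ j) s) = 0 := fun i ↦
    apply_pow_apply_eq_zero_of_rel ψ (dY (x i)) _ (h.pow_natDegree_apply_eq_of_smulFun_eq_zero hg hks hgs) (h0 i)
  have h2 : ∀ i (f : IwasawaAlgebra p), dY (f • x i) s = 0 := fun i f ↦ by
    obtain ⟨N, hN⟩ := h.nil s
    rw [dY_smul W κ hγ Hsub φ hφ dY hT hC, h.smulFun_eq_comp, AddMonoidHom.comp_apply,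
      h.smulFun_id_apply f hN hks, map_sum]
    exact Finset.sum_eq_zero fun j _ ↦ by rw [map_nsmul, h1 i j, smul_zero]
  have h3 : ∀ y : Y, ∀ f : IwasawaAlgebra p, dY (f • y) s = 0 := by
    intro y
    have hy : y ∈ Submodule.span (IwasawaAlgebra p) (Set.range x) := by
      rw [hx]; exact Submodule.mem_top
    induction hy using Submodule.span_induction with
    | mem y hy => obtain ⟨i, rfl⟩ := hy; exact h2 i
    | zero => intro f; rw [smul_zero, map_zero, AddMonoidHom.zero_apply]
    | add y z _ _ hy hz => intro f; rw [smul_add, map_add, AddMonoidHom.add_apply, hy, hz, add_zero]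
    | smul a y _ hy => intro f; rw [smul_smul]; exact hy _
  by_contra hs
  obtain ⟨χ, hχ⟩ := CharacterModule.exists_character_apply_ne_zero_of_ne_zero hs
  obtain ⟨y, rfl⟩ := hbij.2 χ
  have h4 := h3 y 1
  rw [one_smul] at h4
  exact hχ h4

include hT hC in
/-- **`Hsub[g, p^k]` is finite of order `≤ p^{k·d·deg g}`** for `g` monic and `Y` generated by `d` elements (VERBATIM
`SelmerDualData.finite_smulTorsion_and_natCard_le`). [cite: GreenbergLNM1716, §1 p. 62] [cite: Washington1997, §13.2] -/
theorem finite_smulTorsion_and_natCard_le (hbij : Function.Bijective dY) {d : ℕ} (x : Fin d → Y)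
    (hx : Submodule.span (IwasawaAlgebra p) (Set.range x) = ⊤) {g : ℤ_[p][X]} (hg : g.Monic) (k : ℕ) :
    {s : Hsub | (W.isLocNil_sub_one_of_coe_eq_conjH1 κ hγ Hsub φ hφ).smulFun (g : IwasawaAlgebra p)
        (AddMonoidHom.id Hsub) s = 0 ∧ p ^ k • s = 0}.Finite ∧
      Nat.card {s : Hsub | (W.isLocNil_sub_one_of_coe_eq_conjH1 κ hγ Hsub φ hφ).smulFun
        (g : IwasawaAlgebra p) (AddMonoidHom.id Hsub) s = 0 ∧ p ^ k • s = 0} ≤ p ^ (k * (d * g.natDegree)) := by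
  set h := W.isLocNil_sub_one_of_coe_eq_conjH1 κ hγ Hsub φ hφ
  set ψ : AddMonoid.End Hsub := φ - 1
  set Sg := {s : Hsub | h.smulFun (g : IwasawaAlgebra p) (AddMonoidHom.id Hsub) s = 0 ∧ p ^ k • s = 0}
  set Tk := {q : AddCircle (1 : ℚ) | p ^ k • q = 0}
  have hpk : 0 < p ^ k := pow_pos (Nat.Prime.pos Fact.out) k
  obtain ⟨hTfin, hTcard⟩ := finite_and_natCard_addCircle_torsion_le hpk
  haveI : Finite Tk := hTfin.to_subtype
  have hmem : ∀ (s : Sg) (i : Fin d) (j : Fin g.natDegree), dY (x i) ((ψ ^ (j : ℕ)) (s : Hsub)) ∈ Tk := fun s i j ↦ by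
    show p ^ k • dY (x i) ((ψ ^ (j : ℕ)) (s : Hsub)) = 0
    rw [← map_nsmul, nsmul_pow_apply_eq_zero s.2.2, map_zero]
  let Φ : Sg → (Fin d → Fin g.natDegree → Tk) := fun s i j ↦ ⟨_, hmem s i j⟩
  have hΦ : Function.Injective Φ := by
    intro s t hst
    apply Subtype.ext
    rw [← sub_eq_zero]
    have hsub_k : p ^ k • ((s : Hsub) - t) = 0 := by rw [smul_sub, s.2.2, t.2.2, sub_zero]
    have hsub_g : h.smulFun (g : IwasawaAlgebra p) (AddMonoidHom.id _) ((s : Hsub) - t) = 0 := by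
      rw [map_sub, s.2.1, t.2.1, sub_zero]
    refine eq_zero_of_forall_dY_pow_apply_eq_zero W κ hγ Hsub φ hφ dY hT hC hbij x hx hg hsub_k hsub_g fun i j hj ↦ ?_
    have hij : ((Φ s i ⟨j, hj⟩ : Tk) : AddCircle (1 : ℚ)) = ((Φ t i ⟨j, hj⟩ : Tk) : AddCircle (1 : ℚ)) := by rw [hst]
    rw [map_sub, map_sub, sub_eq_zero]
    exact hij
  have hfin : Finite Sg := Finite.of_injective Φ hΦ
  refine ⟨hfin, ?_⟩
  calc Nat.card Sg ≤ Nat.card (Fin d → Fin g.natDegree → Tk) := Nat.card_le_card_of_injective Φ hΦ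
    _ = ((Nat.card Tk) ^ g.natDegree) ^ d := by rw [Nat.card_fun, Nat.card_fun, Nat.card_fin, Nat.card_fin]
    _ ≤ ((p ^ k) ^ g.natDegree) ^ d := Nat.pow_le_pow_left (Nat.pow_le_pow_left hTcard _) _
    _ = p ^ (k * (d * g.natDegree)) := by rw [← pow_mul, ← pow_mul, Nat.mul_comm g.natDegree d]

include hT hC in
/-- **A torsion finitely generated dual forces `p^n g ⋆ Hsub = 0` for a distinguished `g`**: the annihilator of `Y` contains a nonzero
`f` (`Module.annihilator_ne_bot_of_isTorsion`), `f = p^n·g·u` by Weierstrass preparation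
(`IwasawaAlgebra.exists_isDistinguishedAt_of_forall_smul_eq_zero`), and `p^n g` kills every class because its action read through the
characters `dY y` (all characters, `dY` onto) is the canonical one (`dY_smul`, `smulFun_eq_comp`; characters separate points).
[cite: GreenbergLNM1716, §1 p. 60] [cite: Washington1997, §13.2 and Thm. 7.3] -/
theorem exists_isDistinguishedAt_forall_nsmul_eq_zero_of_isTorsion (hbij : Function.Bijective dY)
    [Module.Finite (IwasawaAlgebra p) Y] (hY : Module.IsTorsion (IwasawaAlgebra p) Y) :
    ∃ (n : ℕ) (g : ℤ_[p][X]), g.IsDistinguishedAt (IsLocalRing.maximalIdeal ℤ_[p]) ∧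
      ∀ s : Hsub, p ^ n • (W.isLocNil_sub_one_of_coe_eq_conjH1 κ hγ Hsub φ hφ).smulFun (g : IwasawaAlgebra p)
        (AddMonoidHom.id Hsub) s = 0 := by
  set h := W.isLocNil_sub_one_of_coe_eq_conjH1 κ hγ Hsub φ hφ
  obtain ⟨f, hf, hf0⟩ := (Submodule.ne_bot_iff _).1
    (Literature.NumberTheory.EllipticCurves.Module.annihilator_ne_bot_of_isTorsion Y hY)
  obtain ⟨n, g, hg, hng⟩ :=
    Literature.NumberTheory.EllipticCurves.IwasawaAlgebra.exists_isDistinguishedAt_of_forall_smul_eq_zero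
      hf0 fun x ↦ Module.mem_annihilator.1 hf x
  refine ⟨n, g, hg, fun s ↦ ?_⟩
  rw [← h.smulFun_C_pow_mul_apply]
  set F : IwasawaAlgebra p := PowerSeries.C ((p : ℤ_[p]) ^ n) * (g : IwasawaAlgebra p)
  -- every character kills `F ⋆ s`
  by_contra hs
  obtain ⟨χ, hχ⟩ := CharacterModule.exists_character_apply_ne_zero_of_ne_zero hs
  obtain ⟨y, rfl⟩ := hbij.2 χ
  have h1 : dY (F • y) = h.smulFun F (dY y) := dY_smul W κ hγ Hsub φ hφ dY hT hC F y
  rw [hng y, map_zero, h.smulFun_eq_comp] at h1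
  have h2 := DFunLike.congr_fun h1 s
  rw [AddMonoidHom.zero_apply, AddMonoidHom.comp_apply] at h2
  exact hχ h2.symm

/-- **`Hsub[ω_m, p^k] = {s | conj_{γ^m} s = s, p^k s = 0}`** (`ω_m = (T+1)^m − 1`, `T ↦ φ − 1`, `φ^m = conj_{γ^m}`). [folklore] -/
theorem setOf_smulFun_omega_eq (m k : ℕ) :
    {s : Hsub | (W.isLocNil_sub_one_of_coe_eq_conjH1 κ hγ Hsub φ hφ).smulFun
        (((Polynomial.X + 1) ^ m - 1 : ℤ_[p][X]) : IwasawaAlgebra p) (AddMonoidHom.id Hsub) s = 0 ∧ p ^ k • s = 0} =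
      {s : Hsub | W.conjH1 p κ.kerSubgroup (γ ^ m) (s : W.subgroupH1 p κ.kerSubgroup) = s ∧ p ^ k • s = 0} := by
  refine Set.ext fun s ↦ ?_
  simp only [Set.mem_setOf_eq]
  rw [(W.isLocNil_sub_one_of_coe_eq_conjH1 κ hγ Hsub φ hφ).smulFun_id_omega_apply φ rfl, sub_eq_zero,
    ← coe_pow_apply_of_coe_eq_conjH1' W κ Hsub φ hφ m s]
  constructor
  · rintro ⟨h1, h2⟩; exact ⟨by rw [h1], h2⟩
  · rintro ⟨h1, h2⟩; exact ⟨Subtype.ext h1, h2⟩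

/-! ## §3 Torsion dual ⇒ bounded growth; the non-torsion criteria -/

include hγ hφ hT hC in
/-- **If the dual `Y` of `Hsub` is finitely generated and `Λ`-torsion, the `ℤ_p`-corank of `Hsub^{γ^{pⁿ}}` is bounded independently of
`n`**: there is `B` such that for every `n` there is `C` with `{s ∈ Hsub | conj_{γ^{pⁿ}} s = s, p^k s = 0}` finite of order `≤ C · p^{kB}`
for every `k` (VERBATIM `SelmerDualData.exists_natCard_fixedBy_torsion_le_of_isTorsion`).
[cite: GreenbergLNM1716, §1 (paragraph after Thm 1.7, p. 62)] [cite: Washington1997, §13.3] -/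
theorem exists_natCard_fixedBy_torsion_le_of_isTorsion (hbij : Function.Bijective dY)
    [Module.Finite (IwasawaAlgebra p) Y] (hY : Module.IsTorsion (IwasawaAlgebra p) Y) :
    ∃ B : ℕ, ∀ n : ℕ, ∃ C : ℕ, ∀ k : ℕ,
      {s : Hsub | W.conjH1 p κ.kerSubgroup (γ ^ p ^ n) (s : W.subgroupH1 p κ.kerSubgroup) = s ∧ p ^ k • s = 0}.Finite ∧
      Nat.card {s : Hsub | W.conjH1 p κ.kerSubgroup (γ ^ p ^ n) (s : W.subgroupH1 p κ.kerSubgroup) = s ∧ p ^ k • s = 0} ≤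
        C * p ^ (k * B) := by
  set h := W.isLocNil_sub_one_of_coe_eq_conjH1 κ hγ Hsub φ hφ
  obtain ⟨d, x, hx⟩ := Module.Finite.exists_fin (R := IwasawaAlgebra p) (M := Y)
  obtain ⟨M, g, hg, hMg⟩ := exists_isDistinguishedAt_forall_nsmul_eq_zero_of_isTorsion W κ hγ Hsub φ hφ dY hT hC hbij hY
  refine ⟨d * g.natDegree, fun n ↦ ?_⟩
  set ω : ℤ_[p][X] := (Polynomial.X + 1) ^ p ^ n - 1
  have hX1 : (Polynomial.X + 1 : ℤ_[p][X]).Monic := by rw [← Polynomial.C_1]; exact Polynomial.monic_X_add_C 1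
  have hX1deg : (Polynomial.X + 1 : ℤ_[p][X]).natDegree = 1 := by rw [← Polynomial.C_1]; exact Polynomial.natDegree_X_add_C 1
  have hωm : ω.Monic := by
    refine (hX1.pow (p ^ n)).sub_of_left (Polynomial.degree_lt_degree ?_)
    rw [Polynomial.natDegree_one, hX1.natDegree_pow, hX1deg, mul_one]
    exact pow_pos (Nat.Prime.pos Fact.out) n
  obtain ⟨hCfin, hCcard⟩ := finite_smulTorsion_and_natCard_le W κ hγ Hsub φ hφ dY hT hC hbij x hx hωm M
  refine ⟨p ^ (M * (d * ω.natDegree)), fun k ↦ ?_⟩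
  rw [← setOf_smulFun_omega_eq W κ hγ Hsub φ hφ]
  obtain ⟨hKfin, hKcard⟩ := finite_smulTorsion_and_natCard_le W κ hγ Hsub φ hφ dY hT hC hbij x hx hg.monic k
  haveI : Finite {s : Hsub | h.smulFun (ω : IwasawaAlgebra p) (AddMonoidHom.id _) s = 0 ∧ p ^ M • s = 0} := hCfin.to_subtype
  haveI : Finite {s : Hsub | h.smulFun (g : IwasawaAlgebra p) (AddMonoidHom.id _) s = 0 ∧ p ^ k • s = 0} := hKfin.to_subtype
  let A : AddSubgroup Hsub :=
    { carrier := {s | h.smulFun (ω : IwasawaAlgebra p) (AddMonoidHom.id _) s = 0 ∧ p ^ k • s = 0}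
      add_mem' := fun {a b} ha hb ↦ ⟨by rw [map_add, ha.1, hb.1, add_zero], by rw [smul_add, ha.2, hb.2, add_zero]⟩
      zero_mem' := ⟨map_zero _, smul_zero _⟩
      neg_mem' := fun {a} ha ↦ ⟨by rw [map_neg, ha.1, neg_zero], by rw [smul_neg, ha.2, neg_zero]⟩ }
  let ρ : A →+ Hsub := (h.smulFun (g : IwasawaAlgebra p) (AddMonoidHom.id _)).comp A.subtype
  let ιK : ρ.ker → {s : Hsub | h.smulFun (g : IwasawaAlgebra p) (AddMonoidHom.id _) s = 0 ∧ p ^ k • s = 0} :=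
    fun a ↦ ⟨(a : A), (AddMonoidHom.mem_ker).mp a.2, a.1.2.2⟩
  have hιK : Function.Injective ιK := by
    intro a b hab
    have h' := congrArg Subtype.val hab
    exact Subtype.ext (Subtype.ext h')
  let ιR : ρ.range → {s : Hsub | h.smulFun (ω : IwasawaAlgebra p) (AddMonoidHom.id _) s = 0 ∧ p ^ M • s = 0} :=
    fun t ↦ ⟨(t : Hsub), by
      obtain ⟨a, ha⟩ := AddMonoidHom.mem_range.mp t.2
      refine ⟨?_, ?_⟩
      · rw [← ha, AddMonoidHom.comp_apply, AddSubgroup.coe_subtype, h.smulFun_id_comm_apply, a.2.1, map_zero]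
      · rw [← ha, AddMonoidHom.comp_apply, AddSubgroup.coe_subtype]
        exact hMg _⟩
  have hιR : Function.Injective ιR := by
    intro a b hab
    have h' := congrArg Subtype.val hab
    exact Subtype.ext h'
  haveI : Finite ρ.ker := Finite.of_injective ιK hιK
  haveI : Finite ρ.range := Finite.of_injective ιR hιR
  have hker : Nat.card ρ.ker ≤ p ^ (k * (d * g.natDegree)) := (Nat.card_le_card_of_injective ιK hιK).trans hKcard
  have hrange : Nat.card ρ.range ≤ p ^ (M * (d * ω.natDegree)) := (Nat.card_le_card_of_injective ιR hιR).trans hCcard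
  have hcard : Nat.card A = Nat.card ρ.ker * Nat.card ρ.range := by
    rw [← AddSubgroup.index_ker, AddSubgroup.card_mul_index]
  have hA : Nat.card A ≤ p ^ (M * (d * ω.natDegree)) * p ^ (k * (d * g.natDegree)) := by
    rw [hcard, Nat.mul_comm]
    exact Nat.mul_le_mul hrange hker
  have hAfin : Finite A := by
    apply Nat.finite_of_card_ne_zero
    rw [hcard]
    exact Nat.mul_ne_zero Nat.card_pos.ne' Nat.card_pos.ne'
  exact ⟨Set.finite_coe_iff.mp hAfin, hA⟩

include hγ hφ hT hC in
/-- **Non-torsion criterion by unbounded growth of `Hsub^{γ^{pⁿ}}[p^k]`** (contrapositive of `exists_natCard_fixedBy_torsion_le_of_isTorsion`;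
VERBATIM `SelmerDualData.not_isTorsion_of_unbounded_fixedBy_torsion`). [cite: GreenbergLNM1716, §1 (Thm 1.7 and after, pp. 61–62)] -/
theorem not_isTorsion_of_unbounded_fixedBy_torsion (hbij : Function.Bijective dY) [Module.Finite (IwasawaAlgebra p) Y]
    (H : ∀ B : ℕ, ∃ n : ℕ, ∀ C : ℕ, ∃ (k : ℕ) (F : Finset Hsub),
      (∀ s ∈ F, W.conjH1 p κ.kerSubgroup (γ ^ p ^ n) (s : W.subgroupH1 p κ.kerSubgroup) = s ∧ p ^ k • s = 0) ∧
        C * p ^ (k * B) < F.card) :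
    ¬ Module.IsTorsion (IwasawaAlgebra p) Y := fun hY ↦ by
  obtain ⟨B, hB⟩ := exists_natCard_fixedBy_torsion_le_of_isTorsion W κ hγ Hsub φ hφ dY hT hC hbij hY
  obtain ⟨n, hn⟩ := H B
  obtain ⟨C, hC'⟩ := hB n
  obtain ⟨k, F, hF, hlt⟩ := hn C
  obtain ⟨hfin, hle⟩ := hC' k
  haveI := hfin.to_subtype
  let ι : F → {s : Hsub | W.conjH1 p κ.kerSubgroup (γ ^ p ^ n) (s : W.subgroupH1 p κ.kerSubgroup) = s ∧ p ^ k • s = 0} :=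
    fun s ↦ ⟨s, hF s s.2⟩
  have hι : Function.Injective ι := by
    intro a b hab
    have h' := congrArg Subtype.val hab
    exact Subtype.ext h'
  have := Nat.card_le_card_of_injective ι hι
  rw [Nat.card_eq_finsetCard] at this
  exact lt_irrefl _ (hlt.trans_le (this.trans hle))

include hγ hφ hT hC in
/-- **Unbounded exponents suffice** (VERBATIM `SelmerDualData.not_isTorsion_of_le_card_fixedBy_torsion`): if for all `n`, `k` there are at least
`p^{k·r(n)}/c(n)` classes of `Hsub` fixed by `conj_{γ^{pⁿ}}` and killed by `p^k`, with `r` unbounded, then a finitely generated dual `Y` is not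
`Λ`-torsion. [cite: GreenbergLNM1716, §1 (paragraph after Thm 1.7, p. 62)] -/
theorem not_isTorsion_of_le_card_fixedBy_torsion (hbij : Function.Bijective dY) [Module.Finite (IwasawaAlgebra p) Y]
    (r c : ℕ → ℕ) (hr : ∀ B : ℕ, ∃ n, B < r n)
    (H : ∀ n k : ℕ, ∃ F : Finset Hsub,
      (∀ s ∈ F, W.conjH1 p κ.kerSubgroup (γ ^ p ^ n) (s : W.subgroupH1 p κ.kerSubgroup) = s ∧ p ^ k • s = 0) ∧
        p ^ (k * r n) ≤ c n * F.card) :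
    ¬ Module.IsTorsion (IwasawaAlgebra p) Y := by
  refine not_isTorsion_of_unbounded_fixedBy_torsion W κ hγ Hsub φ hφ dY hT hC hbij fun B ↦ ?_
  obtain ⟨n, hn⟩ := hr B
  refine ⟨n, fun C ↦ ?_⟩
  obtain ⟨k, hk⟩ : ∃ k : ℕ, C * c n < p ^ k := ⟨C * c n, Nat.lt_pow_self (Nat.Prime.one_lt Fact.out)⟩
  obtain ⟨F, hF, hcard⟩ := H n k
  refine ⟨k, F, hF, Nat.lt_of_mul_lt_mul_left (a := c n) ?_⟩
  have hpos : 0 < p ^ (k * B) := pow_pos (Nat.Prime.pos Fact.out) _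
  calc c n * (C * p ^ (k * B)) = C * c n * p ^ (k * B) := by ring
    _ < p ^ k * p ^ (k * B) := (Nat.mul_lt_mul_right hpos).mpr hk
    _ = p ^ (k * (B + 1)) := by rw [← pow_add, show k + k * B = k * (B + 1) by ring]
    _ ≤ p ^ (k * r n) := Nat.pow_le_pow_right (Nat.Prime.pos Fact.out) (Nat.mul_le_mul_left k hn)
    _ ≤ c n * F.card := hcard

end Summit.BirchSwinnertonDyer.BirchSwinnertonDyer.Theorems.SignedEC.H1SigmaGrowth

end
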